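/-
Copyright: pub-rosobs cell (Resolution Observatory), carver gen 39.  Companion file; statements OURS, in
the cell's polynomial weighted-centre model `W(f)`.  Instrument — NOT a resolution theorem.
-/
import Literature.AlgebraicGeometry.Resolution.WeightedCentreStep
import Mathlib.Algebra.MvPolynomial.Division
import Mathlib.Algebra.Polynomial.Degree.Lemmas
import Mathlib.Algebra.Polynomial.Degree.Domain
import Mathlib.RingTheory.Polynomial.Basic
import Mathlib.Algebra.CharP.Two
import HarnessLib

/-!
# The second face: `(2,3,3) ∉ W(v² + u w² + z^q)`

[cite: Temkin2025, §1.2.2 (1) (p. 4) (Włodarczyk's example: in characteristic 2 the hypersurface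
`x² + y²z` has multi-order `(2,3,3)` at every closed point of the `z`-axis but `(2,2)` at its generic
point)]; [cite: AbramovichTemkinWlodarczyk2024, Thm. 5.3.1 (2) (p. 1578) (`inv = max` over admissible
centres), §5.1]; [cite: CossartJannsenSaito2020, Def. 1.26 (initial forms along a regular subscheme)].

In the polynomial model (`admissibleInvariants`, carver g≤36) the Whitney umbrella `v² + u w²` has
`max W = (2,3,3)` in every characteristic (g39, `isMaxInv_umbrella`), the centre being `(v, w, u)` with
weights `(1/2, 1/3, 1/3)`, i.e. the `u`-AXIS blown up with those weights.  This file proves the first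
SECOND-FACE statements of the model: adding a `q`-th power of a fourth variable, `q` invertible in `k`,
leaves NO positive-dimensional centre at or above `(2,3,…)` —

* `not_isCentreFor_umbrellaAddPow`: no centre of `v² + u w² + z^q` has one weight `1/2`, all other
  non-zero weights `1/3`, and some weight `0` — for ALL polynomial coordinate changes;
* hence `[2] ∉ W`, `[2,3] ∉ W`, **`[2,3,3] ∉ W(v² + u w² + z^q)`** (`two_cons_not_mem_admissibleInvariants…`,
  `not_mem_admissibleInvariants_umbrellaAddPow_of_ne_zero`), in particular over every field of characteristic
  `2` for odd `q ≥ 3` (`not_mem_admissibleInvariants_umbrellaAddPow`, the shape `UMB₂ + y^q` of the cell's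
  census, whose recorded value is `(2,3,3,q)`).

What is NOT proved here: the exclusion of the point centres `(2, b₂, b₃, b₄) > (2,3,3,q)` (first-face
arguments as in `isMaxInv_umbrella`, and `b₄ ≤ q`), i.e. the full `max W = (2,3,3,q)`; spectator variables.

Method (derived here, elementary; no primality or dimension theory): if `(Ψ, γ)` were such a centre,
restrict to the centre curve by `ρ = (kill the centre variables, keep ONE weight-0 variable T) ∘ Ψ⁻¹ :
k[X] → k[T]` and take first and second TAYLOR COEFFICIENTS along it (`taylorHom ρ x : X_i ↦ ρ(X_i) +
δ_{ix}·ε`, an algebra map to `k[T][ε]`; admissibility makes `Ψ`-images of monomials of `Ψ⁻¹f` divisible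
by the corresponding power of `ε`, `X_pow_dvd_taylorHom`).  This yields `ρ(v) = ρ(w) = ρ(z) = 0`, then
`1 = a_v²·r` and `ρ(u) = a_w²·r` in `k[T]`; hence `a_v` is a constant and `deg ρ(u)` is even; but every
`ρ(p)` is a polynomial in `ρ(u)`, while `ρ(Ψ X_d) = T` has degree `1`.  (This is the kernel form of
"`u` is not a square in `k[u]`": the form `v² + u w²` stays anisotropic over the centre.)
-/

noncomputable section

open MvPolynomial

namespace Literature.AlgebraicGeometry.Resolution.WeightedBlowup

variable {k : Type*} [Field k] {N : ℕ}

/-! ## §1 Taylor coefficients along an algebra map `ρ : k[X] → k[T]` -/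

section Taylor

/-- **Taylor map** in the direction `x` at the `k[T]`-point `(ρ X_i)_i`: `X_i ↦ ρ(X_i) + δ_{ix} ε`, an
algebra map `k[X] → k[T][ε]`. (construction, derived here) [cite: CossartJannsenSaito2020, Def. 1.26
(initial forms along a regular subscheme)] -/
def taylorHom (ρ : MvPolynomial (Fin N) k →ₐ[k] Polynomial k) (x : Fin N) :
    MvPolynomial (Fin N) k →ₐ[k] Polynomial (Polynomial k) :=
  aeval fun i => Polynomial.C (ρ (X i)) + if i = x then Polynomial.X else 0

/-- The Taylor map on a variable (plumbing). [cite: CossartJannsenSaito2020, Def. 1.26] -/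
theorem taylorHom_X (ρ : MvPolynomial (Fin N) k →ₐ[k] Polynomial k) (x i : Fin N) :
    taylorHom ρ x (X i) = Polynomial.C (ρ (X i)) + if i = x then Polynomial.X else 0 := by
  rw [taylorHom, aeval_X]

/-- The `ε⁰`-coefficient of the Taylor map is `ρ` itself. (derived here)
[cite: CossartJannsenSaito2020, Def. 1.26] -/
theorem eval_zero_taylorHom (ρ : MvPolynomial (Fin N) k →ₐ[k] Polynomial k) (x : Fin N)
    (q : MvPolynomial (Fin N) k) : (taylorHom ρ x q).eval 0 = ρ q := by
  have key : (Polynomial.evalRingHom 0).comp (taylorHom ρ x).toRingHom = ρ.toRingHom := by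
    refine ringHom_ext (fun r => ?_) (fun i => ?_)
    · rw [RingHom.comp_apply, AlgHom.toRingHom_eq_coe, AlgHom.toRingHom_eq_coe, RingHom.coe_coe,
        RingHom.coe_coe, ← MvPolynomial.algebraMap_eq, AlgHom.commutes, AlgHom.commutes,
        Polynomial.algebraMap_apply, Polynomial.coe_evalRingHom, Polynomial.eval_C]
    · rw [RingHom.comp_apply, AlgHom.toRingHom_eq_coe, AlgHom.toRingHom_eq_coe, RingHom.coe_coe,
        RingHom.coe_coe, taylorHom_X, Polynomial.coe_evalRingHom, Polynomial.eval_add, Polynomial.eval_C]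
      split_ifs <;> simp
  have := congrArg (fun φ : MvPolynomial (Fin N) k →+* Polynomial k => φ q) key
  simpa using this

/-- Elements of `ker ρ` have Taylor expansion divisible by `ε`. (derived here)
[cite: CossartJannsenSaito2020, Def. 1.26] -/
theorem X_dvd_taylorHom (ρ : MvPolynomial (Fin N) k →ₐ[k] Polynomial k) (x : Fin N)
    {q : MvPolynomial (Fin N) k} (hq : ρ q = 0) : Polynomial.X ∣ taylorHom ρ x q := by
  rw [Polynomial.X_dvd_iff, Polynomial.coeff_zero_eq_eval_zero, eval_zero_taylorHom, hq]

/-- Taylor expansion of (the image of) a monomial is the product of the expansions. (plumbing) [folklore] -/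
private theorem taylorHom_map_monomial (ρ : MvPolynomial (Fin N) k →ₐ[k] Polynomial k) (x : Fin N)
    (Φ : MvPolynomial (Fin N) k →ₐ[k] MvPolynomial (Fin N) k) (m : Fin N →₀ ℕ) (c : k) :
    taylorHom ρ x (Φ (monomial m c)) =
      Polynomial.C (Polynomial.C c) * ∏ i, (taylorHom ρ x (Φ (X i))) ^ (m i) := by
  rw [monomial_eq, Finsupp.prod_fintype _ _ (fun i => pow_zero _), map_mul, map_mul, algHom_C,
    AlgHom.commutes, map_prod, map_prod]
  congr 1
  exact Finset.prod_congr rfl fun i _ => by rw [map_pow, map_pow]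

/-- **Order of vanishing along the centre.**  If `ρ` kills `Φ(X_i)` for `i ∈ S` and every monomial of
`B` has `S`-degree `≥ n`, then `ε^n ∣ Taylor(Φ B)`. (derived here)
[cite: CossartJannsenSaito2020, Def. 1.26 (the `I`-adic initial form)] -/
theorem X_pow_dvd_taylorHom (ρ : MvPolynomial (Fin N) k →ₐ[k] Polynomial k) (x : Fin N)
    (Φ : MvPolynomial (Fin N) k →ₐ[k] MvPolynomial (Fin N) k) (S : Finset (Fin N))
    (hS : ∀ i ∈ S, ρ (Φ (X i)) = 0) {n : ℕ} (B : MvPolynomial (Fin N) k)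
    (hB : ∀ m ∈ B.support, n ≤ ∑ i ∈ S, m i) :
    Polynomial.X ^ n ∣ taylorHom ρ x (Φ B) := by
  classical
  conv_rhs => rw [B.as_sum]
  rw [map_sum, map_sum]
  refine Finset.dvd_sum fun m hm => ?_
  rw [taylorHom_map_monomial]
  refine Dvd.dvd.mul_left ?_ _
  calc Polynomial.X ^ n ∣ Polynomial.X ^ (∑ i ∈ S, m i) := pow_dvd_pow _ (hB m hm)
    _ = ∏ i ∈ S, Polynomial.X ^ (m i) := (Finset.prod_pow_eq_pow_sum S m _).symm
    _ ∣ ∏ i ∈ S, (taylorHom ρ x (Φ (X i))) ^ (m i) :=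
        Finset.prod_dvd_prod_of_dvd _ _ fun i hi => pow_dvd_pow_of_dvd (X_dvd_taylorHom ρ x (hS i hi)) _
    _ ∣ ∏ i, (taylorHom ρ x (Φ (X i))) ^ (m i) :=
        Finset.prod_dvd_prod_of_subset _ _ _ (Finset.subset_univ S)

/-- Coefficients below the order of vanishing are zero. (plumbing) [folklore] -/
private theorem coeff_eq_zero_of_X_pow_dvd {p : Polynomial (Polynomial k)} {n j : ℕ}
    (h : Polynomial.X ^ n ∣ p) (hj : j < n) : p.coeff j = 0 := by
  obtain ⟨r, rfl⟩ := h
  rw [Polynomial.coeff_X_pow_mul', if_neg (by omega)]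

/-- The `ε²`-coefficient of `(ε η)² · L` is `η(0)² · L(0)`. (plumbing) [folklore] -/
private theorem coeff_two_X_mul_sq_mul (η L : Polynomial (Polynomial k)) :
    ((Polynomial.X * η) ^ 2 * L).coeff 2 = (η.eval 0) ^ 2 * L.eval 0 := by
  have : (Polynomial.X * η) ^ 2 * L = Polynomial.X ^ 2 * (η ^ 2 * L) := by ring
  rw [this, Polynomial.coeff_X_pow_mul', if_pos le_rfl, Nat.sub_self, Polynomial.coeff_zero_eq_eval_zero,
    Polynomial.eval_mul, Polynomial.eval_pow]

end Taylor

/-! ## §2 The exponent list `[2,3,3]` pins the weights -/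

section Weights

/-- `(γ i)⁻¹ ∈ exps γ` for `γ i ≠ 0` (plumbing). [folklore] -/
private theorem inv_mem_exps'' {γ : Fin N → ℚ} {i : Fin N} (hi : γ i ≠ 0) : (γ i)⁻¹ ∈ exps γ := by
  classical
  unfold exps
  rw [List.mem_insertionSort, List.mem_map]
  exact ⟨i, Finset.mem_toList.2 (Finset.mem_filter.2 ⟨Finset.mem_univ _, hi⟩), rfl⟩

/-- The length of `exps γ` is the number of non-zero weights (plumbing). [folklore] -/
private theorem length_exps' (γ : Fin N → ℚ) :
    (exps γ).length = (Finset.univ.filter fun i => γ i ≠ 0).card := by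
  classical
  unfold exps
  rw [List.length_insertionSort, List.length_map, Finset.length_toList]

/-- **`exps γ = 2 :: l` with all entries of `l` equal to `3` and fewer non-zero weights than variables**:
one weight `1/2`, every other non-zero weight `1/3`, and some weight `0`. (derived here)
[cite: AbramovichTemkinWlodarczyk2024, §5.1 (p. 1575) (the invariant lists the exponents `1/γ_i` of the
centre increasingly)] -/
theorem weights_of_exps_eq_two_cons {γ : Fin N → ℚ} {l : List ℚ} (h : exps γ = (2 : ℚ) :: l)
    (hl : ∀ x ∈ l, x = 3) (hlen : l.length + 1 < N) :
    ∃ a d : Fin N, γ a = 1 / 2 ∧ γ d = 0 ∧ ∀ i, i ≠ a → γ i ≠ 0 → γ i = 1 / 3 := by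
  classical
  have hval : ∀ i, γ i ≠ 0 → γ i = 1 / 2 ∨ γ i = 1 / 3 := by
    intro i hi
    have hm := inv_mem_exps'' hi
    rw [h, List.mem_cons] at hm
    rcases hm with h2 | h3
    · left; rw [← inv_inv (γ i), h2]; norm_num
    · right; rw [← inv_inv (γ i), hl _ h3]; norm_num
  have hcount : (Finset.univ.filter fun i => γ i ≠ 0 ∧ (γ i)⁻¹ ≤ 2).card = 1 := by
    rw [← countP_exps, h, List.countP_cons_of_pos (by decide), List.countP_eq_zero.2 fun x hx => ?_]
    rw [hl x hx]; decide
  obtain ⟨a, ha⟩ := Finset.card_eq_one.1 hcount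
  have hmem : ∀ i, i ∈ (Finset.univ.filter fun i => γ i ≠ 0 ∧ (γ i)⁻¹ ≤ 2) ↔ i = a := by
    intro i; rw [ha, Finset.mem_singleton]
  have ha' := (hmem a).2 rfl
  rw [Finset.mem_filter] at ha'
  have hγa : γ a = 1 / 2 := by
    rcases hval a ha'.2.1 with h2 | h3
    · exact h2
    · exfalso; have := ha'.2.2; rw [h3] at this; norm_num at this
  have hcard : (Finset.univ.filter fun i => γ i ≠ 0).card = l.length + 1 := by
    rw [← length_exps', h]; rfl
  have hd : ∃ d, γ d = 0 := by
    by_contra hne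
    push Not at hne
    have : (Finset.univ.filter fun i => γ i ≠ 0) = Finset.univ :=
      Finset.filter_true_of_mem fun i _ => hne i
    rw [this, Finset.card_univ, Fintype.card_fin] at hcard
    omega
  obtain ⟨d, hd⟩ := hd
  refine ⟨a, d, hγa, hd, fun i hia hi => ?_⟩
  rcases hval i hi with h2 | h3
  · exfalso; apply hia
    rw [← hmem, Finset.mem_filter]
    exact ⟨Finset.mem_univ _, hi, by rw [h2]; norm_num⟩
  · exact h3

/-- **`exps γ = [2,3,3]` on four variables**: one weight `1/2`, every other non-zero weight `1/3`, and one
weight `0`. (derived here) [cite: AbramovichTemkinWlodarczyk2024, §5.1 (p. 1575) (the invariant lists the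
exponents `1/γ_i` of the centre increasingly)] -/
theorem weights_of_exps_eq_233 {γ : Fin 4 → ℚ} (h : exps γ = [(2 : ℚ), 3, 3]) :
    ∃ a d : Fin 4, γ a = 1 / 2 ∧ γ d = 0 ∧ (∀ i, i ≠ a → γ i ≠ 0 → γ i = 1 / 3) ∧
      (Finset.univ.filter fun i => γ i ≠ 0).card = 3 := by
  classical
  have hval : ∀ i, γ i ≠ 0 → γ i = 1 / 2 ∨ γ i = 1 / 3 := by
    intro i hi
    have hm := inv_mem_exps'' hi
    rw [h] at hm
    simp only [List.mem_cons, List.not_mem_nil, or_false] at hm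
    rcases hm with h2 | h3 | h3
    · left; rw [← inv_inv (γ i), h2]; norm_num
    · right; rw [← inv_inv (γ i), h3]; norm_num
    · right; rw [← inv_inv (γ i), h3]; norm_num
  have hcount : (Finset.univ.filter fun i => γ i ≠ 0 ∧ (γ i)⁻¹ ≤ 2).card = 1 := by
    rw [← countP_exps, h]; norm_num
  obtain ⟨a, ha⟩ := Finset.card_eq_one.1 hcount
  have hmem : ∀ i, i ∈ (Finset.univ.filter fun i => γ i ≠ 0 ∧ (γ i)⁻¹ ≤ 2) ↔ i = a := by
    intro i; rw [ha, Finset.mem_singleton]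
  have ha' := (hmem a).2 rfl
  rw [Finset.mem_filter] at ha'
  have hγa : γ a = 1 / 2 := by
    rcases hval a ha'.2.1 with h2 | h3
    · exact h2
    · exfalso; have := ha'.2.2; rw [h3] at this; norm_num at this
  have hcard : (Finset.univ.filter fun i => γ i ≠ 0).card = 3 := by
    rw [← length_exps', h]; rfl
  have hd : ∃ d, γ d = 0 := by
    by_contra hne
    push Not at hne
    have : (Finset.univ.filter fun i => γ i ≠ 0) = Finset.univ :=
      Finset.filter_true_of_mem fun i _ => hne i
    rw [this, Finset.card_univ, Fintype.card_fin] at hcard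
    omega
  obtain ⟨d, hd⟩ := hd
  refine ⟨a, d, hγa, hd, fun i hia hi => ?_, hcard⟩
  rcases hval i hi with h2 | h3
  · exfalso; apply hia
    rw [← hmem, Finset.mem_filter]
    exact ⟨Finset.mem_univ _, hi, by rw [h2]; norm_num⟩
  · exact h3

end Weights

/-! ## §3 The second face of `v² + u w² + z^q` -/

section SecondFace

variable (k)

/-- `v² + u w² + z^q` on `𝔸⁴`, with `v, w, u, z = X 0, X 1, X 2, X 3` (the census normal form "umbrella plus an
odd power"). [cite: Temkin2025, §1.2.2 (1) (p. 4) (`x² + y²z`)] -/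
def umbrellaAddPow (q : ℕ) : MvPolynomial (Fin 4) k := X 0 ^ 2 + X 2 * X 1 ^ 2 + X 3 ^ q

variable {k}

/-- **Second face, weight form: no positive-dimensional centre of `v² + u w² + z^q` with weights
`1/2, 1/3, …, 1/3, 0, …`** (`q` invertible in `k`, `q ≥ 2`), for ALL polynomial coordinate changes `Ψ`.
(The Whitney umbrella `v² + u w²` alone HAS such a centre, `(v, w, u)` along the `z`-axis; the power `z^q`
kills `z` along the centre, and the only remaining freedom would need `u` to be a square along it.)
(derived here) [cite: Temkin2025, §1.2.2 (1) (p. 4); AbramovichTemkinWlodarczyk2024, Thm. 5.3.1 (2)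
(p. 1578); CossartJannsenSaito2020, Def. 1.26] -/
theorem not_isCentreFor_umbrellaAddPow {q : ℕ} (hqk : (q : k) ≠ 0) (hq2 : 2 ≤ q)
    {Ψ : MvPolynomial (Fin 4) k ≃ₐ[k] MvPolynomial (Fin 4) k} {γ : Fin 4 → ℚ} {a d : Fin 4}
    (hγa : γ a = 1 / 2) (hγd : γ d = 0) (hthird : ∀ i, i ≠ a → γ i ≠ 0 → γ i = 1 / 3) :
    ¬ IsCentreFor (umbrellaAddPow k q) Ψ γ := by
  classical
  intro hc
  set g := Ψ.symm (umbrellaAddPow k q) with hg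
  have hfg : umbrellaAddPow k q = Ψ g := by rw [hg, AlgEquiv.apply_symm_apply]
  set S := Finset.univ.filter (fun i : Fin 4 => γ i ≠ 0) with hS
  have haS : a ∈ S := Finset.mem_filter.2 ⟨Finset.mem_univ _, by rw [hγa]; norm_num⟩
  -- (J) admissibility of the centre, read on the monomials of `g = Ψ⁻¹ f`
  have hJ : ∀ m ∈ g.support, 2 ≤ ∑ i ∈ S, m i ∧ (2 ≤ m a ∨ 3 ≤ ∑ i ∈ S, m i) := by
    intro m hm
    have h1 : (1 : ℚ) ≤ monomialValuation γ m := hc.2.2 m hm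
    have hv : monomialValuation γ m = ∑ i ∈ S, (m i : ℚ) * γ i := by
      rw [monomialValuation, Finsupp.sum_fintype _ _ (fun i => by simp),
        ← Finset.sum_filter_add_sum_filter_not Finset.univ (fun i => γ i ≠ 0),
        Finset.sum_eq_zero (s := Finset.univ.filter fun i => ¬ γ i ≠ 0) (fun i hi => ?_), add_zero]
      have : γ i = 0 := by simpa using (Finset.mem_filter.1 hi).2
      rw [this, mul_zero]
    have hsplit : ∑ i ∈ S, (m i : ℚ) * γ i =
        (m a : ℚ) * (1 / 2) + ∑ i ∈ S.erase a, (m i : ℚ) * (1 / 3) := by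
      rw [← Finset.add_sum_erase S _ haS, hγa]
      congr 1
      refine Finset.sum_congr rfl fun i hi => ?_
      rw [hthird i (Finset.ne_of_mem_erase hi) (Finset.mem_filter.1 (Finset.mem_of_mem_erase hi)).2]
    have hsumS : (∑ i ∈ S, (m i : ℚ)) = (m a : ℚ) + ∑ i ∈ S.erase a, (m i : ℚ) :=
      (Finset.add_sum_erase S _ haS).symm
    have hma : m a ≤ ∑ i ∈ S, m i :=
      Finset.single_le_sum (f := fun i => m i) (fun i _ => Nat.zero_le _) haS
    have key : (6 : ℚ) ≤ 2 * ((∑ i ∈ S, m i : ℕ) : ℚ) + (m a : ℕ) := by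
      rw [Nat.cast_sum, hsumS]
      rw [hv, hsplit, ← Finset.sum_mul] at h1
      linarith
    have key' : 6 ≤ 2 * (∑ i ∈ S, m i) + m a := by exact_mod_cast key
    omega
  -- the restriction to the centre curve, parametrised by the weight-0 variable: ρ = κ ∘ Ψ⁻¹
  obtain ⟨κ, hκ⟩ : ∃ κ : MvPolynomial (Fin 4) k →ₐ[k] Polynomial k,
      ∀ i, κ (X i) = if γ i ≠ 0 then (0 : Polynomial k) else Polynomial.X :=
    ⟨aeval _, fun i => aeval_X _ i⟩
  obtain ⟨ρ, hρ⟩ : ∃ ρ : MvPolynomial (Fin 4) k →ₐ[k] Polynomial k, ∀ p, ρ p = κ (Ψ.symm p) :=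
    ⟨κ.comp (Ψ.symm : MvPolynomial (Fin 4) k →ₐ[k] MvPolynomial (Fin 4) k), fun p => rfl⟩
  have hρΨ : ∀ i, ρ (Ψ (X i)) = if γ i ≠ 0 then (0 : Polynomial k) else Polynomial.X := by
    intro i; rw [hρ, AlgEquiv.symm_apply_apply, hκ]
  have hρS : ∀ i ∈ S, ρ (Ψ.toAlgHom (X i)) = 0 := by
    intro i hi
    rw [AlgEquiv.toAlgHom_apply, hρΨ, if_pos (Finset.mem_filter.1 hi).2]
  have hρd : ρ (Ψ (X d)) = Polynomial.X := by rw [hρΨ, if_neg (not_not.2 hγd)]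
  -- Taylor expansions of f: explicit form
  have hT : ∀ x, taylorHom ρ x (umbrellaAddPow k q) =
      (Polynomial.C (ρ (X 0)) + if (0 : Fin 4) = x then Polynomial.X else 0) ^ 2
      + (Polynomial.C (ρ (X 2)) + if (2 : Fin 4) = x then Polynomial.X else 0) *
        (Polynomial.C (ρ (X 1)) + if (1 : Fin 4) = x then Polynomial.X else 0) ^ 2
      + (Polynomial.C (ρ (X 3)) + if (3 : Fin 4) = x then Polynomial.X else 0) ^ q := by
    intro x
    simp only [umbrellaAddPow, map_add, map_mul, map_pow, taylorHom_X]
  -- order ≥ 2 along the centre: the ε⁰ and ε¹ coefficients vanish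
  have hdvd2 : ∀ x, Polynomial.X ^ 2 ∣ taylorHom ρ x (umbrellaAddPow k q) := by
    intro x
    rw [hfg]
    exact X_pow_dvd_taylorHom ρ x Ψ.toAlgHom S hρS g fun m hm => (hJ m hm).1
  have hc0 : ∀ x, (taylorHom ρ x (umbrellaAddPow k q)).coeff 0 = 0 := fun x =>
    coeff_eq_zero_of_X_pow_dvd (hdvd2 x) (by norm_num)
  have hc1 : ∀ x, (taylorHom ρ x (umbrellaAddPow k q)).coeff 1 = 0 := fun x =>
    coeff_eq_zero_of_X_pow_dvd (hdvd2 x) (by norm_num)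
  -- (D1) ρ(w) = 0 from the ε¹-coefficient in the direction u
  have hw0 : ρ (X 1) = 0 := by
    have h := hc1 2
    rw [hT 2] at h
    simp only [if_neg (show ¬ (0 : Fin 4) = 2 by decide), if_neg (show ¬ (1 : Fin 4) = 2 by decide),
      if_neg (show ¬ (3 : Fin 4) = 2 by decide), if_true, add_zero] at h
    have e : (Polynomial.C (ρ (X 0))) ^ 2 + (Polynomial.C (ρ (X 2)) + Polynomial.X) *
        (Polynomial.C (ρ (X 1))) ^ 2 + (Polynomial.C (ρ (X 3))) ^ q
        = Polynomial.C (ρ (X 0) ^ 2 + ρ (X 2) * ρ (X 1) ^ 2 + ρ (X 3) ^ q)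
          + Polynomial.C (ρ (X 1) ^ 2) * Polynomial.X := by
      simp only [map_add, map_mul, map_pow]; ring
    rw [e, Polynomial.coeff_add, Polynomial.coeff_C, if_neg (by norm_num), Polynomial.coeff_C_mul_X,
      if_pos rfl, zero_add] at h
    exact (pow_eq_zero_iff two_ne_zero).1 h
  -- (D2) ρ(z) = 0 from the ε¹-coefficient in the direction z (q odd, characteristic 2)
  have hz0 : ρ (X 3) = 0 := by
    have h := hc1 3
    rw [hT 3] at h
    simp only [if_neg (show ¬ (0 : Fin 4) = 3 by decide), if_neg (show ¬ (1 : Fin 4) = 3 by decide),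
      if_neg (show ¬ (2 : Fin 4) = 3 by decide), if_true, add_zero] at h
    have e : (Polynomial.C (ρ (X 0))) ^ 2 + Polynomial.C (ρ (X 2)) * (Polynomial.C (ρ (X 1))) ^ 2
        = Polynomial.C (ρ (X 0) ^ 2 + ρ (X 2) * ρ (X 1) ^ 2) := by
      simp only [map_add, map_mul, map_pow]
    rw [e, Polynomial.coeff_add, Polynomial.coeff_C, if_neg (by norm_num), zero_add, add_comm (Polynomial.C _),
      Polynomial.coeff_X_add_C_pow, Nat.choose_one_right] at h
    have hqne : (q : Polynomial k) ≠ 0 := by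
      rw [← Polynomial.C_eq_natCast]; exact Polynomial.C_ne_zero.2 hqk
    exact (pow_eq_zero_iff (by omega)).1 ((mul_eq_zero.1 h).resolve_right hqne)
  -- (D3) ρ(f) = 0, hence ρ(v) = 0
  have hρf : ρ (umbrellaAddPow k q) = 0 := by
    rw [← eval_zero_taylorHom ρ 0, ← Polynomial.coeff_zero_eq_eval_zero]; exact hc0 0
  have hv0 : ρ (X 0) = 0 := by
    have h : ρ (X 0) ^ 2 + ρ (X 2) * ρ (X 1) ^ 2 + ρ (X 3) ^ q = 0 := by
      simpa only [umbrellaAddPow, map_add, map_mul, map_pow] using hρf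
    rw [hw0, hz0, zero_pow two_ne_zero, mul_zero, add_zero, zero_pow (by omega), add_zero] at h
    exact (pow_eq_zero_iff two_ne_zero).1 h
  -- (D4) second order: split g = X_a² · A + B, B of S-degree ≥ 3 on every monomial
  set A := MvPolynomial.divMonomial g (Finsupp.single a 2) with hA
  set B := MvPolynomial.modMonomial g (Finsupp.single a 2) with hB
  have hgAB : g = X a ^ 2 * A + B := by
    rw [X_pow_eq_monomial]; exact (divMonomial_add_modMonomial g _).symm
  have hB3 : ∀ m ∈ B.support, 3 ≤ ∑ i ∈ S, m i := by
    intro m hm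
    rw [mem_support_iff] at hm
    have hnot : ¬ Finsupp.single a 2 ≤ m := fun hle => hm (coeff_modMonomial_of_le g hle)
    rw [coeff_modMonomial_of_not_le g hnot] at hm
    have hma : m a < 2 := by rw [Finsupp.single_le_iff] at hnot; omega
    rcases (hJ m (mem_support_iff.2 hm)).2 with h2 | h3
    · omega
    · exact h3
  have hfAB : umbrellaAddPow k q = Ψ (X a) ^ 2 * Ψ A + Ψ B := by
    rw [hfg, hgAB, map_add, map_mul, map_pow]
  have hc2 : ∀ x, ∃ ax : Polynomial k,
      (taylorHom ρ x (umbrellaAddPow k q)).coeff 2 = ax ^ 2 * ρ (Ψ A) := by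
    intro x
    obtain ⟨η, hη⟩ := X_dvd_taylorHom ρ x (hρS a haS)
    rw [AlgEquiv.toAlgHom_apply] at hη
    refine ⟨η.eval 0, ?_⟩
    have hB0 : (taylorHom ρ x (Ψ B)).coeff 2 = 0 :=
      coeff_eq_zero_of_X_pow_dvd (X_pow_dvd_taylorHom ρ x Ψ.toAlgHom S hρS B hB3) (by norm_num)
    rw [hfAB, map_add, map_mul, map_pow, Polynomial.coeff_add, hB0, add_zero, hη, coeff_two_X_mul_sq_mul,
      eval_zero_taylorHom]
  -- (D5) the same coefficients, computed directly: 1 in the direction v, ρ(u) in the direction w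
  have hcv : (taylorHom ρ 0 (umbrellaAddPow k q)).coeff 2 = 1 := by
    rw [hT 0, hv0, hw0, hz0, map_zero]
    simp only [if_true, if_neg (show ¬ (2 : Fin 4) = 0 by decide), if_neg (show ¬ (1 : Fin 4) = 0 by decide),
      if_neg (show ¬ (3 : Fin 4) = 0 by decide), add_zero, zero_add, zero_pow two_ne_zero, mul_zero,
      zero_pow (show q ≠ 0 by omega), Polynomial.coeff_X_pow]
  have hcw : (taylorHom ρ 1 (umbrellaAddPow k q)).coeff 2 = ρ (X 2) := by
    rw [hT 1, hv0, hw0, hz0, map_zero]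
    simp only [if_true, if_neg (show ¬ (0 : Fin 4) = 1 by decide), if_neg (show ¬ (2 : Fin 4) = 1 by decide),
      if_neg (show ¬ (3 : Fin 4) = 1 by decide), add_zero, zero_add, zero_pow two_ne_zero,
      zero_pow (show q ≠ 0 by omega), Polynomial.coeff_C_mul, Polynomial.coeff_X_pow, mul_one]
  obtain ⟨av, hav⟩ := hc2 0
  obtain ⟨aw, haw⟩ := hc2 1
  rw [hcv] at hav
  rw [hcw] at haw
  -- (D6) `a_v² ρ(u) = a_w²` with `a_v` constant: the degree of ρ(u) is even
  have hrel : av ^ 2 * ρ (X 2) = aw ^ 2 := by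
    rw [haw]; linear_combination (-(aw ^ 2)) * hav
  have hav0 : av ≠ 0 := by
    rintro rfl
    rw [zero_pow two_ne_zero, zero_mul] at hav
    exact one_ne_zero hav
  have hdav : av.natDegree = 0 := by
    have hr0 : ρ (Ψ A) ≠ 0 := by
      intro h0; rw [h0, mul_zero] at hav; exact one_ne_zero hav
    have h := congrArg Polynomial.natDegree hav
    rw [Polynomial.natDegree_one, Polynomial.natDegree_mul (pow_ne_zero 2 hav0) hr0,
      Polynomial.natDegree_pow] at h
    omega
  have hdeg : (ρ (X 2)).natDegree = 2 * aw.natDegree := by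
    by_cases hu : ρ (X 2) = 0
    · have haw0 : aw = 0 := by
        have : aw ^ 2 = 0 := by rw [← hrel, hu, mul_zero]
        exact (pow_eq_zero_iff two_ne_zero).1 this
      rw [hu, haw0, Polynomial.natDegree_zero, mul_zero]
    · have h := congrArg Polynomial.natDegree hrel
      rw [Polynomial.natDegree_mul (pow_ne_zero 2 hav0) hu, Polynomial.natDegree_pow, hdav, mul_zero,
        zero_add, Polynomial.natDegree_pow] at h
      exact h
  -- (D7) every ρ(p) is a polynomial in ρ(u); but ρ(Ψ X_d) = T has odd degree
  obtain ⟨κu, hκu⟩ : ∃ κu : MvPolynomial (Fin 4) k →ₐ[k] Polynomial k,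
      ∀ i, κu (X i) = if i = 2 then Polynomial.X else 0 :=
    ⟨aeval _, fun i => aeval_X _ i⟩
  have hρeq : ρ = (Polynomial.aeval (ρ (X 2))).comp κu := by
    refine MvPolynomial.algHom_ext fun i => ?_
    rw [AlgHom.comp_apply, hκu]
    have hi : i = 0 ∨ i = 1 ∨ i = 2 ∨ i = 3 := by
      rcases i with ⟨i, hi⟩
      have : i = 0 ∨ i = 1 ∨ i = 2 ∨ i = 3 := by omega
      rcases this with rfl | rfl | rfl | rfl
      · exact Or.inl rfl
      · exact Or.inr (Or.inl rfl)
      · exact Or.inr (Or.inr (Or.inl rfl))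
      · exact Or.inr (Or.inr (Or.inr rfl))
    rcases hi with rfl | rfl | rfl | rfl
    · rw [if_neg (by decide), map_zero, hv0]
    · rw [if_neg (by decide), map_zero, hw0]
    · rw [if_pos rfl, Polynomial.aeval_X]
    · rw [if_neg (by decide), map_zero, hz0]
  have hXd : (κu (Ψ (X d))).comp (ρ (X 2)) = Polynomial.X := by
    rw [Polynomial.comp_eq_aeval, ← AlgHom.comp_apply, ← hρeq, hρd]
  have h := congrArg Polynomial.natDegree hXd
  rw [Polynomial.natDegree_comp, Polynomial.natDegree_X, hdeg] at h
  have heven : Even ((κu (Ψ (X d))).natDegree * (2 * aw.natDegree)) := (even_two_mul _).mul_left _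
  rw [h] at heven
  exact Nat.not_even_one heven

/-- **`2 :: l ∉ W(v² + u w² + z^q)`** for `l ∈ {[], [3], [3,3]}`: no positive-dimensional centre reaches
`(2, 3, …)` (`q` invertible in `k`, `q ≥ 2`). (derived here) [cite: Temkin2025, §1.2.2 (1) (p. 4);
AbramovichTemkinWlodarczyk2024, Thm. 5.3.1 (2) (p. 1578)] -/
theorem two_cons_not_mem_admissibleInvariants_umbrellaAddPow {q : ℕ} (hqk : (q : k) ≠ 0) (hq2 : 2 ≤ q)
    {l : List ℚ} (hl : ∀ x ∈ l, x = 3) (hlen : l.length < 3) :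
    (2 : ℚ) :: l ∉ admissibleInvariants (umbrellaAddPow k q) := by
  rintro ⟨Ψ, γ, hc, hexps⟩
  obtain ⟨a, d, hγa, hγd, hthird⟩ := weights_of_exps_eq_two_cons hexps hl (by omega)
  exact not_isCentreFor_umbrellaAddPow hqk hq2 hγa hγd hthird hc

/-- **Second face: `(2,3,3) ∉ W(v² + u w² + z^q)`** (`q` invertible in `k`, `q ≥ 2`): the value `(2,3,3)`
of the Whitney umbrella is NOT attained once `z^q` is added — for all polynomial coordinate changes.
(derived here) [cite: Temkin2025, §1.2.2 (1) (p. 4); AbramovichTemkinWlodarczyk2024, Thm. 5.3.1 (2)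
(p. 1578)] -/
theorem not_mem_admissibleInvariants_umbrellaAddPow_of_ne_zero {q : ℕ} (hqk : (q : k) ≠ 0) (hq2 : 2 ≤ q) :
    [(2 : ℚ), 3, 3] ∉ admissibleInvariants (umbrellaAddPow k q) :=
  two_cons_not_mem_admissibleInvariants_umbrellaAddPow hqk hq2 (l := [3, 3]) (by simp) (by decide)

/-- Also `[2,3] ∉ W` and `[2] ∉ W(v² + u w² + z^q)`. (derived here)
[cite: AbramovichTemkinWlodarczyk2024, Thm. 5.3.1 (2) (p. 1578)] -/
theorem two_three_not_mem_admissibleInvariants_umbrellaAddPow {q : ℕ} (hqk : (q : k) ≠ 0) (hq2 : 2 ≤ q) :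
    [(2 : ℚ), 3] ∉ admissibleInvariants (umbrellaAddPow k q) ∧
      [(2 : ℚ)] ∉ admissibleInvariants (umbrellaAddPow k q) :=
  ⟨two_cons_not_mem_admissibleInvariants_umbrellaAddPow hqk hq2 (l := [3]) (by simp) (by decide),
    two_cons_not_mem_admissibleInvariants_umbrellaAddPow hqk hq2 (l := []) (by simp) (by decide)⟩

/-- **The census shape (characteristic 2, `q` odd, `q ≥ 3`): `(2,3,3) ∉ W(v² + u w² + z^q)`** over every
field of characteristic `2` — the recorded value of these points is `(2,3,3,q)`. (derived here)
[cite: Temkin2025, §1.2.2 (1) (p. 4); AbramovichTemkinWlodarczyk2024, Thm. 5.3.1 (2) (p. 1578)] -/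
theorem not_mem_admissibleInvariants_umbrellaAddPow [CharP k 2] {q : ℕ} (hq : Odd q) (hq3 : 3 ≤ q) :
    [(2 : ℚ), 3, 3] ∉ admissibleInvariants (umbrellaAddPow k q) := by
  refine not_mem_admissibleInvariants_umbrellaAddPow_of_ne_zero (fun h => ?_) (by omega)
  obtain ⟨r, rfl⟩ := hq
  rw [Nat.cast_add, Nat.cast_mul, Nat.cast_two, CharTwo.two_eq_zero, zero_mul, zero_add, Nat.cast_one] at h
  exact one_ne_zero h

end SecondFace

end Literature.AlgebraicGeometry.Resolution.WeightedBlowup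

end
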